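import Summits.QuantumAdvantage.QuantumAdvantage.Theorems.CubicForrelationNearExactIsExactCubicFormR4LevelCells
import Summits.QuantumAdvantage.QuantumAdvantage.Theorems.CubicForrelationNearExactIsExactCubicFormR4CellForms
import Summits.QuantumAdvantage.QuantumAdvantage.Theorems.CubicForrelationNearExactIsExactCubicFormR4QfCells
import Summits.QuantumAdvantage.QuantumAdvantage.Theorems.CubicForrelationNearExactIsExactCubicFormR4QfPolar
import Summits.QuantumAdvantage.QuantumAdvantage.Theorems.CubicForrelationNearExactIsExactCubicFormR4QfRadical

/-!
# Crux `CubicForrelation.NearExactIsExact` (stmt-QuantumAdvantage-14043) — E1280-even, R4 branch: the descendant `x₁q₄` (`HL 2`) is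
  contradictory

Certificate seat `b2b-cforr-cert` (gen 43).  HONEST FRAMING: kernel-checked theorem (standard axioms) discharging ONE of the three named
endgames (`HZ`, `HL 1`, `HL 2`) of …CubicFormR4PartnerDispatch / …CubicFormR4PartnerAssembly; `HZ` and `HL 1` remain, so `HR4` and
`θ₁₂ = 57/64` are NOT yet kernel theorems; `θ₁₂ ∈ [57/64, 29/32)` is formally unchanged; NOT summit progress.

`tpw_R4_level_two` is LITERALLY the hypothesis `HL2` of `tpw_R4_HL_of_levels`: in the adapted R4 frame (`y_a = e₀`, `v = e₁..e₄`,
`z = e₅..e₁₁`, frame identity `κ(y) ⊕ κ(y ⊕ e₀) = y₁y₂ ⊕ y₃y₄`, `hF`) with a partnered cubic form (`hpair`), weight `< 1280` and a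
lightest `Z₁₀`-cell of weight `24` whose third differences are `s₀ ∧ (s₁s₃ + s₂s₄)`, we derive `False`:
1. `tpw_R4_level_cells`: every cell `f_v` (`v ∈ 𝔽₂⁴`) has the same cubic form, weighs `≥ 24`, and `Σ_{Z₁₀} #f_v ≤ 255`; so at most one
   cell of `Z₁₀` is not exact (`tq4_budget`), and every exact cell (`#f_v < 32`) is periodic along `e₅, e₆` (`tq4_cell_period`).
2. Second differences of `κ` along `(z_m, z_k)`, `m ∈ {5, 6}`, at the cell base points are affine in `v` (`tc5_second_rho`) and vanish on the
   exact cells, hence identically (`tq4_affine`): `d(v_t, z_m, z_k) = 0`.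
3. First differences along `z_m` at the cell base points have base-point free second differences in `v` (`tcf_third_const`) and vanish on
   the exact cells; for a suitable `(α, β) ≠ 0` the combination `α D_{z₅} ⊕ β D_{z₆}` vanishes on all of `Z₁₀`, so (`tq4_polar_table`) its
   polar form is `y·(v₀v₁ + v₂v₃)`: `α d(z₅,v_a,v_b) + β d(z₆,v_a,v_b) = y·d(y_a,v_a,v_b)`.
4. `d` vanishes on `z_m × z × z` (the normal form) — so `u = α e_{z₅} + β e_{z₆} + y e_{y_a}` is a radical vector: `tq4_radical`.
R4-PARTNER.md §6's shear and `y_a`-gauge are not needed.  Nothing else about `θ₁₂`.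

References: this seat lineage (g37 R4-PARTNER §1/§6, g39 HANDPROOFS §2.1, g42 dispatch/level cells).  Axioms: the standard three.
-/

set_option linter.dupNamespace false -- D-0017: single-problem summit ⇒ `QuantumAdvantage.QuantumAdvantage` by design

namespace Summit.QuantumAdvantage.QuantumAdvantage.Theorems.CubicForrelation.NearExactIsExact

open Finset
open Literature.Computability.QuantumComplexity
open Literature.Computability.QuantumComplexity.BuzetChailloux (bxor zeroVec bxor_comm bxor_self bxor_zeroVec zeroVec_bxor
  bxor_bxor_cancel_left)

/-- Bool bookkeeping: second differences of `α·q ⊕ β·q'` from those of `q`, `q'`. [folklore] -/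
theorem tq4_xor_comb : ∀ (α β a b c d a' b' c' d' : Bool),
    ((((α && a) ^^ (β && a')) ^^ ((α && b) ^^ (β && b'))) ^^ (((α && c) ^^ (β && c')) ^^ ((α && d) ^^ (β && d')))) =
      ((α && ((a ^^ b) ^^ (c ^^ d))) ^^ (β && ((a' ^^ b') ^^ (c' ^^ d')))) := by
  decide

/-- `[α ∧ x] = [α]·[x]` in `𝔽₂`. [folklore] -/
theorem tq4_ite_and (α x : Bool) :
    (if (α && x) = true then (1 : ZMod 2) else 0) = (if α = true then (1 : ZMod 2) else 0) * (if x = true then (1 : ZMod 2) else 0) := by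
  revert α x; decide

/-- **Descendant `x₁q₄` is contradictory** — literally hypothesis `HL2` of `tpw_R4_HL_of_levels` (…CubicFormR4PartnerAssembly).
See the module docstring for the proof. [this work] -/
theorem tpw_R4_level_two : ∀ (hk : 1 + 2 + 2 ≤ 7), 1 ≤ 2 → 2 ≤ 2 →
    ∀ (κ : (Fin (5 + 7) → Bool) → Bool), IsDegLeFun 3 κ →
    ∀ (c d : Fin (5 + 7) → Fin (5 + 7) → Fin (5 + 7) → ZMod 2),
    (∀ p j k, c p k j = c p j k) → (∀ p j k, c j p k = c p j k) → (∀ p j, c p j j = 0) →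
    (∀ φ j k, d φ k j = d φ j k) → (∀ φ j k, d j φ k = d φ j k) → (∀ φ j, d φ j j = 0) →
    (∀ φ j k, d φ j k =
      if ((((κ zeroVec ^^ κ (bxor zeroVec (fun l => decide (l = k)))) ^^
              (κ (bxor zeroVec (fun l => decide (l = j))) ^^ κ (bxor (bxor zeroVec (fun l => decide (l = j))) (fun l => decide (l = k))))) ^^
            ((κ (bxor zeroVec (fun l => decide (l = φ))) ^^ κ (bxor (bxor zeroVec (fun l => decide (l = φ))) (fun l => decide (l = k)))) ^^
              (κ (bxor (bxor zeroVec (fun l => decide (l = φ))) (fun l => decide (l = j))) ^^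
                κ (bxor (bxor (bxor zeroVec (fun l => decide (l = φ))) (fun l => decide (l = j))) (fun l => decide (l = k))))))) = true
      then 1 else 0) →
    (∀ p φ, (∑ j, ∑ k, (if j < k then c p j k * d φ j k else 0)) = if p = φ then 1 else 0) →
    (∀ y, (κ y ^^ κ (bxor y (fun l => decide (l = Fin.castAdd 7 (0 : Fin 5))))) =
      ((y (Fin.castAdd 7 (1 : Fin 5)) && y (Fin.castAdd 7 (2 : Fin 5))) ^^ (y (Fin.castAdd 7 (3 : Fin 5)) && y (Fin.castAdd 7 (4 : Fin 5))))) →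
    (∀ j k, d (Fin.castAdd 7 (0 : Fin 5)) j k =
      (if (j = Fin.castAdd 7 (1 : Fin 5) ∧ k = Fin.castAdd 7 (2 : Fin 5)) ∨ (j = Fin.castAdd 7 (2 : Fin 5) ∧ k = Fin.castAdd 7 (1 : Fin 5)) then 1 else 0) +
      (if (j = Fin.castAdd 7 (3 : Fin 5) ∧ k = Fin.castAdd 7 (4 : Fin 5)) ∨ (j = Fin.castAdd 7 (4 : Fin 5) ∧ k = Fin.castAdd 7 (3 : Fin 5)) then 1 else 0)) →
    #(univ.filter fun y : Fin (5 + 7) → Bool => κ y = true) < 1280 →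
    ∀ (vc : Fin 4 → Bool), ((vc 0 && vc 1) ^^ (vc 2 && vc 3)) = false →
    (∀ v' : Fin 4 → Bool, ((v' 0 && v' 1) ^^ (v' 2 && v' 3)) = false →
      #(univ.filter fun s : Fin 7 → Bool => κ (Fin.append (Matrix.vecCons false vc) s) = true) ≤
        #(univ.filter fun s : Fin 7 → Bool => κ (Fin.append (Matrix.vecCons false v') s) = true)) →
    4 * #(univ.filter fun s : Fin 7 → Bool => κ (Fin.append (Matrix.vecCons false vc) s) = true) + 2 ^ (7 - 2) = 2 ^ 7 →
    ∀ (bz : Bool), (∀ s : Fin 7 → Bool, κ (Fin.append (Matrix.vecCons false vc) s) = true → s (Fin.castLE hk (Fin.castAdd 2 (Fin.castAdd 2 (0 : Fin 1)))) = bz) →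
    (∀ u v w x : Fin 7 → Bool,
      ((((κ (Fin.append (Matrix.vecCons false vc) x) ^^ κ (Fin.append (Matrix.vecCons false vc) (bxor x w))) ^^
              (κ (Fin.append (Matrix.vecCons false vc) (bxor x v)) ^^ κ (Fin.append (Matrix.vecCons false vc) (bxor (bxor x v) w)))) ^^
            ((κ (Fin.append (Matrix.vecCons false vc) (bxor x u)) ^^ κ (Fin.append (Matrix.vecCons false vc) (bxor (bxor x u) w))) ^^
              (κ (Fin.append (Matrix.vecCons false vc) (bxor (bxor x u) v)) ^^
                κ (Fin.append (Matrix.vecCons false vc) (bxor (bxor (bxor x u) v) w)))))) =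
      ((((u (Fin.castLE hk (Fin.castAdd 2 (Fin.castAdd 2 (0 : Fin 1)))) &&
            decide ((∑ ii : Fin 2, ((if v (Fin.castLE hk (Fin.castAdd 2 (Fin.natAdd 1 ii))) = true then (1 : ZMod 2) else 0) * (if w (Fin.castLE hk (Fin.natAdd (1 + 2) ii)) = true then (1 : ZMod 2) else 0) +
              (if v (Fin.castLE hk (Fin.natAdd (1 + 2) ii)) = true then (1 : ZMod 2) else 0) * (if w (Fin.castLE hk (Fin.castAdd 2 (Fin.natAdd 1 ii))) = true then (1 : ZMod 2) else 0))) = 1)) ^^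
          (v (Fin.castLE hk (Fin.castAdd 2 (Fin.castAdd 2 (0 : Fin 1)))) &&
            decide ((∑ ii : Fin 2, ((if u (Fin.castLE hk (Fin.castAdd 2 (Fin.natAdd 1 ii))) = true then (1 : ZMod 2) else 0) * (if w (Fin.castLE hk (Fin.natAdd (1 + 2) ii)) = true then (1 : ZMod 2) else 0) +
              (if u (Fin.castLE hk (Fin.natAdd (1 + 2) ii)) = true then (1 : ZMod 2) else 0) * (if w (Fin.castLE hk (Fin.castAdd 2 (Fin.natAdd 1 ii))) = true then (1 : ZMod 2) else 0))) = 1))) ^^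
          (w (Fin.castLE hk (Fin.castAdd 2 (Fin.castAdd 2 (0 : Fin 1)))) &&
            decide ((∑ ii : Fin 2, ((if u (Fin.castLE hk (Fin.castAdd 2 (Fin.natAdd 1 ii))) = true then (1 : ZMod 2) else 0) * (if v (Fin.castLE hk (Fin.natAdd (1 + 2) ii)) = true then (1 : ZMod 2) else 0) +
              (if u (Fin.castLE hk (Fin.natAdd (1 + 2) ii)) = true then (1 : ZMod 2) else 0) * (if v (Fin.castLE hk (Fin.castAdd 2 (Fin.natAdd 1 ii))) = true then (1 : ZMod 2) else 0))) = 1))))) → False := by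
  intro hk h12 h22 κ hκ c d hcs hcc hcd hds hdc hdd hd hpair hD hF hlt vc hvc hmin hex bz hbz hT
  -- Step 0: the cells in normal coordinates (`lo = (0,1)`, `hi = (2,3)` as maps `Fin 2 → Fin 6`; free coordinates `4, 5`)
  obtain ⟨lo, hi, hlo, hhi, hlohi, hlov, hhiv, hshare, -, -, -, hbudget, hcells⟩ :=
    tpw_R4_level_cells κ hκ d hd hD hlt 2 hk h12 h22 vc hT
  have hfree : ∀ (m : Fin 6), 4 ≤ m.val → (∀ i, lo i ≠ m) ∧ (∀ i, hi i ≠ m) := by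
    intro m hm
    refine ⟨fun i h => ?_, fun i h => ?_⟩
    · have e1 := hlov i; rw [h] at e1; have := i.isLt; omega
    · have e1 := hhiv i; rw [h] at e1; have := i.isLt; omega
  obtain ⟨hml4, hmh4⟩ := hfree 4 (by decide)
  obtain ⟨hml5, hmh5⟩ := hfree 5 (by decide)
  have h24 : ∀ v : Fin 4 → Bool, 24 ≤ #(univ.filter fun s : Fin 7 → Bool => κ (Fin.append (Matrix.vecCons false v) s) = true) := by
    intro v
    have e1 := (hcells v).1
    have h8 : (2 : ℕ) ^ (5 - 2) = 8 := by norm_num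
    rw [h8] at e1
    omega
  -- Step 1: exact cells (`< 32` ones) are periodic along `e₅, e₆`
  have hper : ∀ (σ : Fin 7) (m : Fin 6), (Fin.natAdd 1 m : Fin (1 + 6)) = σ → (∀ i, lo i ≠ m) → (∀ i, hi i ≠ m) →
      ∀ v : Fin 4 → Bool, #(univ.filter fun s : Fin 7 → Bool => κ (Fin.append (Matrix.vecCons false v) s) = true) < 32 → ∀ s : Fin 7 → Bool,
        κ (Fin.append (Matrix.vecCons false v) (bxor s (fun l => decide (l = σ)))) = κ (Fin.append (Matrix.vecCons false v) s) := by
    intro σ m hσ hlm hhm v hv s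
    have P := tq4_cell_period (fun s : Fin (1 + 6) → Bool => κ (Fin.append (Matrix.vecCons false v) s)) 2 (by norm_num) (by norm_num)
      lo hi hlo hhi hlohi
      (fun a b : Fin 6 → Bool => decide ((∑ ii : Fin 2, ((if a (lo ii) = true then (1 : ZMod 2) else 0) * (if b (hi ii) = true then (1 : ZMod 2) else 0) +
        (if a (hi ii) = true then (1 : ZMod 2) else 0) * (if b (lo ii) = true then (1 : ZMod 2) else 0))) = 1))
      (fun a b => rfl) (hshare (Matrix.vecCons false v)) hv m hlm hhm s
    rw [hσ] at P
    exact P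
  have hper5 := hper 5 4 rfl hml4 hmh4
  have hper6 := hper 6 5 rfl hml5 hmh5
  -- Step 2: at most one cell of `Z₁₀` is not exact
  obtain ⟨p, -, hpex⟩ : ∃ p : Fin 4 → Bool, ((p 0 && p 1) ^^ (p 2 && p 3)) = false ∧
      ∀ v : Fin 4 → Bool, ((v 0 && v 1) ^^ (v 2 && v 3)) = false → v ≠ p → #(univ.filter fun s : Fin 7 → Bool => κ (Fin.append (Matrix.vecCons false v) s) = true) < 32 := by
    by_cases hall : ∀ v : Fin 4 → Bool, ((v 0 && v 1) ^^ (v 2 && v 3)) = false → #(univ.filter fun s : Fin 7 → Bool => κ (Fin.append (Matrix.vecCons false v) s) = true) < 32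
    · exact ⟨vc, hvc, fun v hv _ => hall v hv⟩
    · push Not at hall
      obtain ⟨p, hpZ, hp32⟩ := hall
      refine ⟨p, hpZ, fun v hv hvp => ?_⟩
      by_contra hv32
      push Not at hv32
      exact tq4_budget (fun v => #(univ.filter fun s : Fin 7 → Bool => κ (Fin.append (Matrix.vecCons false v) s) = true)) h24 hbudget p v hpZ hv (Ne.symm hvp) hp32 hv32
  -- Step 3: `d(v_t, z_σ, z_k) = 0` for `σ ∈ {5, 6}` (second differences along `(z_σ, z_k)` are affine in the cell and vanish on exact cells)
  have haff : ∀ (σ : Fin 7), (∀ v : Fin 4 → Bool, #(univ.filter fun s : Fin 7 → Bool => κ (Fin.append (Matrix.vecCons false v) s) = true) < 32 → ∀ s : Fin 7 → Bool,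
        κ (Fin.append (Matrix.vecCons false v) (bxor s (fun l => decide (l = σ)))) = κ (Fin.append (Matrix.vecCons false v) s)) →
      ∀ (k : Fin 7) (t : Fin 4), d (Fin.castAdd 7 t.succ) (Fin.natAdd 5 σ) (Fin.natAdd 5 k) = 0 := by
    intro σ hperσ k t
    have A := tq4_affine p _ (fun t : Fin 4 =>
      (((κ zeroVec ^^ κ (bxor zeroVec (fun l => decide (l = Fin.natAdd 5 k)))) ^^
            (κ (bxor zeroVec (fun l => decide (l = Fin.natAdd 5 σ))) ^^ κ (bxor (bxor zeroVec (fun l => decide (l = Fin.natAdd 5 σ))) (fun l => decide (l = Fin.natAdd 5 k))))) ^^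
          ((κ (bxor zeroVec (fun l => decide (l = Fin.castAdd 7 t.succ))) ^^ κ (bxor (bxor zeroVec (fun l => decide (l = Fin.castAdd 7 t.succ))) (fun l => decide (l = Fin.natAdd 5 k)))) ^^
            (κ (bxor (bxor zeroVec (fun l => decide (l = Fin.castAdd 7 t.succ))) (fun l => decide (l = Fin.natAdd 5 σ))) ^^
              κ (bxor (bxor (bxor zeroVec (fun l => decide (l = Fin.castAdd 7 t.succ))) (fun l => decide (l = Fin.natAdd 5 σ))) (fun l => decide (l = Fin.natAdd 5 k)))))))
      (fun v hvZ hvp => by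
        have hv := hpex v hvZ hvp
        have h2 := tc5_second_rho κ hκ (Matrix.vecCons false v) σ k
        dsimp only at h2
        have c0 : (Matrix.vecCons false v : Fin 5 → Bool) 0 = false := rfl
        have c1 : (Matrix.vecCons false v : Fin 5 → Bool) 1 = v 0 := rfl
        have c2 : (Matrix.vecCons false v : Fin 5 → Bool) 2 = v 1 := rfl
        have c3 : (Matrix.vecCons false v : Fin 5 → Bool) 3 = v 2 := rfl
        have c4 : (Matrix.vecCons false v : Fin 5 → Bool) 4 = v 3 := rfl
        rw [c0, c1, c2, c3, c4] at h2
        refine (congrArg (fun b => b = false) h2).mp ?_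
        have p1 := hperσ v hv zeroVec
        rw [zeroVec_bxor] at p1
        have p2 := hperσ v hv (fun l => decide (l = k))
        rw [tc5_unit_right σ, tc5_unit_right k]
        simp only [tc5_append_bxor, bxor_zeroVec, zeroVec_bxor]
        rw [bxor_comm (fun l => decide (l = σ)) (fun l => decide (l = k)), p1, p2]
        cases κ (Fin.append (Matrix.vecCons false v) zeroVec) <;>
          cases κ (Fin.append (Matrix.vecCons false v) (fun l => decide (l = k))) <;> rfl)
    have e1 := hd (Fin.castAdd 7 t.succ) (Fin.natAdd 5 σ) (Fin.natAdd 5 k)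
    rw [A.2 t] at e1
    rw [e1]
    simp
  -- Step Z: `d` vanishes on `z_σ × z × z` for `σ ∈ {5, 6}` (the normal form `s₀ ∧ ω₄` does not involve `s₅, s₆`)
  have hzz : ∀ (σ : Fin 7) (m : Fin 6), (Fin.natAdd 1 m : Fin (1 + 6)) = σ → (∀ i, lo i ≠ m) → (∀ i, hi i ≠ m) →
      ∀ j k : Fin 7, d (Fin.natAdd 5 σ) (Fin.natAdd 5 j) (Fin.natAdd 5 k) = 0 := by
    intro σ m hσ hlm hhm j k
    have h3 := tc5_third_rho_unit κ hκ (Matrix.vecCons false vc) σ j k zeroVec zeroVec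
    dsimp only at h3
    rw [hd, ← h3]
    have hC : ((((κ (Fin.append (Matrix.vecCons false vc) zeroVec) ^^ κ (Fin.append (Matrix.vecCons false vc) (bxor zeroVec (fun l => decide (l = k))))) ^^
              (κ (Fin.append (Matrix.vecCons false vc) (bxor zeroVec (fun l => decide (l = j)))) ^^ κ (Fin.append (Matrix.vecCons false vc) (bxor (bxor zeroVec (fun l => decide (l = j))) (fun l => decide (l = k)))))) ^^
            ((κ (Fin.append (Matrix.vecCons false vc) (bxor zeroVec (fun l => decide (l = σ)))) ^^ κ (Fin.append (Matrix.vecCons false vc) (bxor (bxor zeroVec (fun l => decide (l = σ))) (fun l => decide (l = k))))) ^^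
              (κ (Fin.append (Matrix.vecCons false vc) (bxor (bxor zeroVec (fun l => decide (l = σ))) (fun l => decide (l = j)))) ^^
                κ (Fin.append (Matrix.vecCons false vc) (bxor (bxor (bxor zeroVec (fun l => decide (l = σ))) (fun l => decide (l = j))) (fun l => decide (l = k)))))))) = false := by
      have e1 := hshare (Matrix.vecCons false vc) (fun l => decide (l = σ)) (fun l => decide (l = j)) (fun l => decide (l = k)) zeroVec
      subst hσ
      have hc0 : decide ((Fin.castAdd 6 (0 : Fin 1) : Fin (1 + 6)) = Fin.natAdd 1 m) = false :=
        decide_eq_false (fun h => by have := congrArg Fin.val h; simp at this; omega)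
      have hlo' : ∀ ii, decide ((Fin.natAdd 1 (lo ii) : Fin (1 + 6)) = Fin.natAdd 1 m) = false :=
        fun ii => decide_eq_false (fun h => hlm ii ((Fin.natAdd_inj 1).mp h))
      have hhi' : ∀ ii, decide ((Fin.natAdd 1 (hi ii) : Fin (1 + 6)) = Fin.natAdd 1 m) = false :=
        fun ii => decide_eq_false (fun h => hhm ii ((Fin.natAdd_inj 1).mp h))
      have h01 : decide ((0 : ZMod 2) = 1) = false := by decide
      simp only [hc0, hlo', hhi', Bool.false_eq_true, if_false, zero_mul, add_zero, sum_const_zero, h01,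
        Bool.false_and, Bool.and_false, Bool.xor_false] at e1
      exact e1
    rw [hC]
    simp
  have hz5 := hzz 5 4 rfl hml4 hmh4
  have hz6 := hzz 6 5 rfl hml5 hmh5
  -- the embedding `v ↦ X v = (0, v, 0)` of the cell index: additive, `X 0 = 0`, `X e_t = e_{1+t}`
  have hXb : ∀ x t : Fin 4 → Bool, (Fin.append (Matrix.vecCons false (bxor x t)) (zeroVec : Fin 7 → Bool) : Fin (5 + 7) → Bool) =
      bxor (Fin.append (Matrix.vecCons false x) zeroVec) (Fin.append (Matrix.vecCons false t) zeroVec) := by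
    intro x t
    rw [tc5_append_bxor, bxor_zeroVec]
    congr 1
    funext l
    refine Fin.cases ?_ (fun i => ?_) l
    · rfl
    · rfl
  have hX0 : (Fin.append (Matrix.vecCons false (zeroVec : Fin 4 → Bool)) (zeroVec : Fin 7 → Bool) : Fin (5 + 7) → Bool) = zeroVec := by
    funext l
    refine Fin.addCases (fun i => ?_) (fun j => ?_) l
    · rw [Fin.append_left]
      refine Fin.cases rfl (fun i' => rfl) i
    · rw [Fin.append_right]; rfl
  have hXe : ∀ t : Fin 4, (Fin.append (Matrix.vecCons false (fun l => decide (l = t))) (zeroVec : Fin 7 → Bool) : Fin (5 + 7) → Bool) =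
      fun l => decide (l = Fin.castAdd 7 t.succ) := by
    intro t
    rw [tc5_unit_left]
    congr 1
    funext l
    refine Fin.cases ?_ (fun i => ?_) l
    · exact (decide_eq_false (fun h => Fin.succ_ne_zero t h.symm)).symm
    · show decide (i = t) = decide (i.succ = t.succ)
      by_cases h : i = t
      · subst h; simp
      · rw [decide_eq_false h, decide_eq_false (fun h' => h (Fin.succ_inj.mp h'))]
  -- Step 4: first differences along `z_σ` at the cell base points: vanish on exact cells; base-point free second differences in `v`
  have hquad : ∀ (σ : Fin 7), (∀ v : Fin 4 → Bool, #(univ.filter fun s : Fin 7 → Bool => κ (Fin.append (Matrix.vecCons false v) s) = true) < 32 → ∀ s : Fin 7 → Bool,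
        κ (Fin.append (Matrix.vecCons false v) (bxor s (fun l => decide (l = σ)))) = κ (Fin.append (Matrix.vecCons false v) s)) →
      (∀ v : Fin 4 → Bool, #(univ.filter fun s : Fin 7 → Bool => κ (Fin.append (Matrix.vecCons false v) s) = true) < 32 → (κ (Fin.append (Matrix.vecCons false v) zeroVec) ^^ κ (bxor (Fin.append (Matrix.vecCons false v) zeroVec) (fun l => decide (l = Fin.natAdd 5 σ)))) = false) ∧
      (∀ s t x : Fin 4 → Bool,
        (((κ (Fin.append (Matrix.vecCons false x) zeroVec) ^^ κ (bxor (Fin.append (Matrix.vecCons false x) zeroVec) (fun l => decide (l = Fin.natAdd 5 σ)))) ^^ (κ (Fin.append (Matrix.vecCons false (bxor x t)) zeroVec) ^^ κ (bxor (Fin.append (Matrix.vecCons false (bxor x t)) zeroVec) (fun l => decide (l = Fin.natAdd 5 σ))))) ^^ ((κ (Fin.append (Matrix.vecCons false (bxor x s)) zeroVec) ^^ κ (bxor (Fin.append (Matrix.vecCons false (bxor x s)) zeroVec) (fun l => decide (l = Fin.natAdd 5 σ)))) ^^ (κ (Fin.append (Matrix.vecCons false (bxor (bxor x s) t)) zeroVec)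 ^^ κ (bxor (Fin.append (Matrix.vecCons false (bxor (bxor x s) t)) zeroVec) (fun l => decide (l = Fin.natAdd 5 σ)))))) =
        (((κ (Fin.append (Matrix.vecCons false zeroVec) zeroVec) ^^ κ (bxor (Fin.append (Matrix.vecCons false zeroVec) zeroVec) (fun l => decide (l = Fin.natAdd 5 σ)))) ^^ (κ (Fin.append (Matrix.vecCons false (bxor zeroVec t)) zeroVec) ^^ κ (bxor (Fin.append (Matrix.vecCons false (bxor zeroVec t)) zeroVec) (fun l => decide (l = Fin.natAdd 5 σ))))) ^^ ((κ (Fin.append (Matrix.vecCons false (bxor zeroVec s)) zeroVec) ^^ κ (bxor (Fin.append (Matrix.vecCons false (bxor zeroVec s)) zeroVec) (fun l => decide (l = Fin.natAdd 5 σ)))) ^^ (κ (Fin.append (Matrix.vecCons false (bxor (bxor zeroVec s) t)) zeroVec) ^^ κ (bxor (Fin.append (Matrix.vecCons false (bxor (bxor zeroVec s) t)) zeroVec) (fun l => decide (l = Fin.natAdd 5 σ))))))) := by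
    intro σ hperσ
    refine ⟨fun v hv => ?_, fun s t x => ?_⟩
    · rw [tc5_unit_right σ, tc5_append_bxor, bxor_zeroVec, hperσ v hv zeroVec]
      exact Bool.xor_self _
    · simp only [hXb]
      exact tcf_third_const κ hκ _ _ _ _ _
  -- the tables `d(v_a, v_c, z_σ) = [B_σ(e_a, e_c)]`
  have hBd : ∀ (σ : Fin 7) (a c : Fin 4), d (Fin.castAdd 7 a.succ) (Fin.castAdd 7 c.succ) (Fin.natAdd 5 σ) =
      if (((κ (Fin.append (Matrix.vecCons false zeroVec) zeroVec) ^^ κ (bxor (Fin.append (Matrix.vecCons false zeroVec) zeroVec) (fun l => decide (l = Fin.natAdd 5 σ)))) ^^ (κ (Fin.append (Matrix.vecCons false (bxor zeroVec (fun l => decide (l = c)))) zeroVec) ^^ κ (bxor (Fin.append (Matrix.vecCons false (bxor zeroVec (fun l => decide (l = c)))) zeroVec) (fun l => decide (l = Fin.natAdd 5 σ))))) ^^ ((κ (Fin.append (Matrix.vecCons false (bxor zeroVec (fun l => decide (l = a)))) zeroVec) ^^ κ (bxor (Fin.append (Matrix.vecCons false (bxor zeroVec (fun l => decide (l = a))))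 zeroVec) (fun l => decide (l = Fin.natAdd 5 σ)))) ^^ (κ (Fin.append (Matrix.vecCons false (bxor (bxor zeroVec (fun l => decide (l = a))) (fun l => decide (l = c)))) zeroVec) ^^ κ (bxor (Fin.append (Matrix.vecCons false (bxor (bxor zeroVec (fun l => decide (l = a))) (fun l => decide (l = c)))) zeroVec) (fun l => decide (l = Fin.natAdd 5 σ)))))) = true then 1 else 0 := by
    intro σ a c
    rw [hd]
    simp only [hXb, hX0, hXe]
  -- `d(y_a, v_a, v_c)` from `hF`
  have hFab : ∀ a c : Fin 4, d (Fin.castAdd 7 (0 : Fin 5)) (Fin.castAdd 7 a.succ) (Fin.castAdd 7 c.succ) =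
      (if (a = 0 ∧ c = 1) ∨ (a = 1 ∧ c = 0) then (1 : ZMod 2) else 0) + (if (a = 2 ∧ c = 3) ∨ (a = 3 ∧ c = 2) then (1 : ZMod 2) else 0) := by
    intro a c
    rw [hF, show (1 : Fin 5) = Fin.succ (0 : Fin 4) from rfl, show (2 : Fin 5) = Fin.succ (1 : Fin 4) from rfl,
      show (3 : Fin 5) = Fin.succ (2 : Fin 4) from rfl, show (4 : Fin 5) = Fin.succ (3 : Fin 4) from rfl]
    simp only [Fin.castAdd_inj, Fin.succ_inj]
  obtain ⟨hQ5z, hB5⟩ := hquad 5 hper5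
  obtain ⟨hQ6z, hB6⟩ := hquad 6 hper6
  -- Steps 3–4 assembled: for `(α, β) ≠ 0` with `α·D₅ ⊕ β·D₆` vanishing on `Z₁₀`, the radical vector kills the partner
  have main : ∀ (α β : Bool), (α = true ∨ β = true) →
      (∀ v : Fin 4 → Bool, ((v 0 && v 1) ^^ (v 2 && v 3)) = false → ((α && (κ (Fin.append (Matrix.vecCons false v) zeroVec) ^^ κ (bxor (Fin.append (Matrix.vecCons false v) zeroVec) (fun l => decide (l = Fin.natAdd 5 5))))) ^^ (β && (κ (Fin.append (Matrix.vecCons false v) zeroVec) ^^ κ (bxor (Fin.append (Matrix.vecCons false v) zeroVec) (fun l => decide (l = Fin.natAdd 5 6)))))) = false) → False := by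
    intro α β hαβ hvan
    have hB := tq4_polar_table (fun v => (α && (κ (Fin.append (Matrix.vecCons false v) zeroVec) ^^ κ (bxor (Fin.append (Matrix.vecCons false v) zeroVec) (fun l => decide (l = Fin.natAdd 5 5))))) ^^ (β && (κ (Fin.append (Matrix.vecCons false v) zeroVec) ^^ κ (bxor (Fin.append (Matrix.vecCons false v) zeroVec) (fun l => decide (l = Fin.natAdd 5 6))))))
      (fun s t => (α && (((κ (Fin.append (Matrix.vecCons false zeroVec) zeroVec) ^^ κ (bxor (Fin.append (Matrix.vecCons false zeroVec) zeroVec) (fun l => decide (l = Fin.natAdd 5 5)))) ^^ (κ (Fin.append (Matrix.vecCons false (bxor zeroVec t)) zeroVec) ^^ κ (bxor (Fin.append (Matrix.vecCons false (bxor zeroVec t)) zeroVec) (fun l => decide (l = Fin.natAdd 5 5))))) ^^ ((κ (Fin.append (Matrix.vecCons false (bxor zeroVec s)) zeroVec) ^^ κ (bxor (Fin.append (Matrix.vecCons false (bxor zeroVec s)) zeroVec) (fun l => decide (l = Fin.natAdd 5 5)))) ^^ (κ (Fin.append (Matrix.vecCons false (bxor (bxor zeroVec s) t)) zeroVec) ^^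 κ (bxor (Fin.append (Matrix.vecCons false (bxor (bxor zeroVec s) t)) zeroVec) (fun l => decide (l = Fin.natAdd 5 5))))))) ^^
        (β && (((κ (Fin.append (Matrix.vecCons false zeroVec) zeroVec) ^^ κ (bxor (Fin.append (Matrix.vecCons false zeroVec) zeroVec) (fun l => decide (l = Fin.natAdd 5 6)))) ^^ (κ (Fin.append (Matrix.vecCons false (bxor zeroVec t)) zeroVec) ^^ κ (bxor (Fin.append (Matrix.vecCons false (bxor zeroVec t)) zeroVec) (fun l => decide (l = Fin.natAdd 5 6))))) ^^ ((κ (Fin.append (Matrix.vecCons false (bxor zeroVec s)) zeroVec) ^^ κ (bxor (Fin.append (Matrix.vecCons false (bxor zeroVec s)) zeroVec) (fun l => decide (l = Fin.natAdd 5 6)))) ^^ (κ (Fin.append (Matrix.vecCons false (bxor (bxor zeroVec s) t)) zeroVec) ^^ κ (bxor (Fin.append (Matrix.vecCons false (bxor (bxor zeroVec s) t)) zeroVec) (fun l => decide (l = Fin.natAdd 5 6))))))))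
      (fun s t x => by
        rw [← hB5 s t x, ← hB6 s t x]
        exact tq4_xor_comb _ _ _ _ _ _ _ _ _ _) hvan
    refine tq4_radical c d hdc hds hpair hF (if α = true then 1 else 0) (if β = true then 1 else 0)
      ((if α = true then 1 else 0) * d (Fin.natAdd 5 (5 : Fin 7)) (Fin.castAdd 7 (0 : Fin 4).succ) (Fin.castAdd 7 (1 : Fin 4).succ) +
        (if β = true then 1 else 0) * d (Fin.natAdd 5 (6 : Fin 7)) (Fin.castAdd 7 (0 : Fin 4).succ) (Fin.castAdd 7 (1 : Fin 4).succ))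
      ?_ hz5 hz6 (fun t k => by rw [hdc]; exact haff 5 hper5 k t) (fun t k => by rw [hdc]; exact haff 6 hper6 k t) ?_
    · rcases hαβ with h | h
      · left; rw [h]; decide
      · right; rw [h]; decide
    · intro a c'
      have P := hB a c'
      rw [tcf_ite_xor (α && (((κ (Fin.append (Matrix.vecCons false zeroVec) zeroVec) ^^ κ (bxor (Fin.append (Matrix.vecCons false zeroVec) zeroVec) (fun l => decide (l = Fin.natAdd 5 5)))) ^^ (κ (Fin.append (Matrix.vecCons false (bxor zeroVec (fun l => decide (l = c')))) zeroVec) ^^ κ (bxor (Fin.append (Matrix.vecCons false (bxor zeroVec (fun l => decide (l = c')))) zeroVec) (fun l => decide (l = Fin.natAdd 5 5))))) ^^ ((κ (Fin.append (Matrix.vecCons false (bxor zeroVec (fun l => decide (l = a)))) zeroVec) ^^ κ (bxor (Fin.append (Matrix.vecCons false (bxor zeroVec (fun l => decide (l = a)))) zeroVec) (fun l => decide (l = Fin.natAdd 5 5)))) ^^ (κ (Fin.append (Matrix.vecCons false (bxor (bxor zeroVec (fun l => decide (l = a))) (fun l => decide (l = c')))) zeroVec) ^^ κ (bxor (Fin.append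 (Matrix.vecCons false (bxor (bxor zeroVec (fun l => decide (l = a))) (fun l => decide (l = c')))) zeroVec) (fun l => decide (l = Fin.natAdd 5 5)))))))
          (β && (((κ (Fin.append (Matrix.vecCons false zeroVec) zeroVec) ^^ κ (bxor (Fin.append (Matrix.vecCons false zeroVec) zeroVec) (fun l => decide (l = Fin.natAdd 5 6)))) ^^ (κ (Fin.append (Matrix.vecCons false (bxor zeroVec (fun l => decide (l = c')))) zeroVec) ^^ κ (bxor (Fin.append (Matrix.vecCons false (bxor zeroVec (fun l => decide (l = c')))) zeroVec) (fun l => decide (l = Fin.natAdd 5 6))))) ^^ ((κ (Fin.append (Matrix.vecCons false (bxor zeroVec (fun l => decide (l = a)))) zeroVec) ^^ κ (bxor (Fin.append (Matrix.vecCons false (bxor zeroVec (fun l => decide (l = a)))) zeroVec) (fun l => decide (l = Fin.natAdd 5 6)))) ^^ (κ (Fin.append (Matrix.vecCons false (bxor (bxor zeroVec (fun l => decide (l = a))) (fun l => decide (l = c')))) zeroVec) ^^ κ (bxor (Fin.append (Matrix.vecCons false (bxor (bxor zeroVec (fun l => decide (l = a))) (fun l => decide (l = c')))) zeroVec) (fun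 l => decide (l = Fin.natAdd 5 6))))))),
        tcf_ite_xor (α && (((κ (Fin.append (Matrix.vecCons false zeroVec) zeroVec) ^^ κ (bxor (Fin.append (Matrix.vecCons false zeroVec) zeroVec) (fun l => decide (l = Fin.natAdd 5 5)))) ^^ (κ (Fin.append (Matrix.vecCons false (bxor zeroVec (fun l => decide (l = (1 : Fin 4))))) zeroVec) ^^ κ (bxor (Fin.append (Matrix.vecCons false (bxor zeroVec (fun l => decide (l = (1 : Fin 4))))) zeroVec) (fun l => decide (l = Fin.natAdd 5 5))))) ^^ ((κ (Fin.append (Matrix.vecCons false (bxor zeroVec (fun l => decide (l = (0 : Fin 4))))) zeroVec) ^^ κ (bxor (Fin.append (Matrix.vecCons false (bxor zeroVec (fun l => decide (l = (0 : Fin 4))))) zeroVec) (fun l => decide (l = Fin.natAdd 5 5)))) ^^ (κ (Fin.append (Matrix.vecCons false (bxor (bxor zeroVec (fun l => decide (l = (0 : Fin 4)))) (fun l => decide (l = (1 : Fin 4))))) zeroVec) ^^ κ (bxor (Fin.append (Matrix.vecCons false (bxor (bxor zeroVec (fun l => decide (l = (0 : Fin 4)))) (fun l => decide (l = (1 : Fin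 4))))) zeroVec) (fun l => decide (l = Fin.natAdd 5 5)))))))
          (β && (((κ (Fin.append (Matrix.vecCons false zeroVec) zeroVec) ^^ κ (bxor (Fin.append (Matrix.vecCons false zeroVec) zeroVec) (fun l => decide (l = Fin.natAdd 5 6)))) ^^ (κ (Fin.append (Matrix.vecCons false (bxor zeroVec (fun l => decide (l = (1 : Fin 4))))) zeroVec) ^^ κ (bxor (Fin.append (Matrix.vecCons false (bxor zeroVec (fun l => decide (l = (1 : Fin 4))))) zeroVec) (fun l => decide (l = Fin.natAdd 5 6))))) ^^ ((κ (Fin.append (Matrix.vecCons false (bxor zeroVec (fun l => decide (l = (0 : Fin 4))))) zeroVec) ^^ κ (bxor (Fin.append (Matrix.vecCons false (bxor zeroVec (fun l => decide (l = (0 : Fin 4))))) zeroVec) (fun l => decide (l = Fin.natAdd 5 6)))) ^^ (κ (Fin.append (Matrix.vecCons false (bxor (bxor zeroVec (fun l => decide (l = (0 : Fin 4)))) (fun l => decide (l = (1 : Fin 4))))) zeroVec) ^^ κ (bxor (Fin.append (Matrix.vecCons false (bxor (bxor zeroVec (fun l => decide (l = (0 : Fin 4)))) (fun l => decide (l = (1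 : Fin 4))))) zeroVec) (fun l => decide (l = Fin.natAdd 5 6))))))),
        tq4_ite_and, tq4_ite_and, tq4_ite_and, tq4_ite_and] at P
      -- move every `d(z_σ, v_a, v_c)` to `d(v_a, v_c, z_σ)` and tabulate
      have hsw : ∀ (σ : Fin 7) (a c : Fin 4), d (Fin.natAdd 5 σ) (Fin.castAdd 7 a.succ) (Fin.castAdd 7 c.succ) =
          d (Fin.castAdd 7 a.succ) (Fin.castAdd 7 c.succ) (Fin.natAdd 5 σ) := by
        intro σ a c
        rw [hdc (Fin.castAdd 7 a.succ) (Fin.natAdd 5 σ) (Fin.castAdd 7 c.succ), hds (Fin.castAdd 7 a.succ) (Fin.castAdd 7 c.succ) (Fin.natAdd 5 σ)]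
      rw [hsw, hsw, hsw, hsw, hBd, hBd, hBd, hBd, hFab]
      exact P
  -- the choice of `(α, β)`
  by_cases h5 : ∀ v : Fin 4 → Bool, ((v 0 && v 1) ^^ (v 2 && v 3)) = false → (κ (Fin.append (Matrix.vecCons false v) zeroVec) ^^ κ (bxor (Fin.append (Matrix.vecCons false v) zeroVec) (fun l => decide (l = Fin.natAdd 5 5)))) = false
  · exact main true false (Or.inl rfl) (fun v hv => by rw [h5 v hv]; rfl)
  by_cases h6 : ∀ v : Fin 4 → Bool, ((v 0 && v 1) ^^ (v 2 && v 3)) = false → (κ (Fin.append (Matrix.vecCons false v) zeroVec) ^^ κ (bxor (Fin.append (Matrix.vecCons false v) zeroVec) (fun l => decide (l = Fin.natAdd 5 6)))) = false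
  · exact main false true (Or.inr rfl) (fun v hv => by rw [h6 v hv]; rfl)
  refine main true true (Or.inl rfl) (fun v hv => ?_)
  push Not at h5 h6
  obtain ⟨v5, hv5Z, hv5⟩ := h5
  obtain ⟨v6, hv6Z, hv6⟩ := h6
  -- both exceptional cells are the non-exact cell `p`
  have e5 : v5 = p := by
    by_contra hne
    exact hv5 (hQ5z v5 (hpex v5 hv5Z hne))
  have e6 : v6 = p := by
    by_contra hne
    exact hv6 (hQ6z v6 (hpex v6 hv6Z hne))
  rw [e5] at hv5
  rw [e6] at hv6
  by_cases hvp : v = p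
  · subst hvp
    revert hv5 hv6
    cases (κ (Fin.append (Matrix.vecCons false v) zeroVec) ^^ κ (bxor (Fin.append (Matrix.vecCons false v) zeroVec) (fun l => decide (l = Fin.natAdd 5 5)))) <;> cases (κ (Fin.append (Matrix.vecCons false v) zeroVec) ^^ κ (bxor (Fin.append (Matrix.vecCons false v) zeroVec) (fun l => decide (l = Fin.natAdd 5 6)))) <;> decide
  · rw [hQ5z v (hpex v hv hvp), hQ6z v (hpex v hv hvp)]
    rfl

end Summit.QuantumAdvantage.QuantumAdvantage.Theorems.CubicForrelation.NearExactIsExact
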